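import Summits.KontsevichZagierPeriods.KontsevichZagierPeriods.Theses.SymplecticScissors
import Summits.KontsevichZagierPeriods.KontsevichZagierPeriods.Theorems.PlanarK0Injective.Negative.Kit
import Literature.NumberTheory.Transcendental.KZLogCalculusProofs
import Literature.NumberTheory.Transcendental.SemialgebraicMapsProofs

/-!
# `PlanarCompiler`, stub `stub_band` — helper I: the vertical shear is a change of variables

Crux stmt-KontsevichZagierPeriods-10058 (`PlanarCompiler`, route SymplecticScissors), line
`twist-restoring-shear`, stub `stub_band` (the band identity for one cell). This helper file proves
the one geometric move the band identity needs: over an open base `G ⊆ ℝᵐ` on which a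
`ℚ`-semialgebraic function `α` is differentiable, the translation along the last coordinate
`Φ (y, s) = (y, α y + s)` carries the open band `{(y, s) | y ∈ G, a y < s < b y}` onto the open band
with edges `α + a`, `α + b`; between integrand-`1` representations on these two bands `[r] − [r']`
is ONE instance of Kontsevich–Zagier's rule 2 (`|det DΦ| = 1`, `LinearMap.det_of_snoc_init`).
The proof is adapted from `KZ.of_sub_of_mem_relations_of_affine` (closed bands, conclusion in
`relations`) in `Literature/NumberTheory/Transcendental/KZLogCalculusProofs.lean`.

[Kontsevich–Zagier 2001, §1.2, rule 2)] [folklore]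
-/

noncomputable section

open MeasureTheory Set
open Literature.NumberTheory.Transcendental Literature.ModelTheory.ExponentialFields

namespace Summit.KontsevichZagierPeriods.SymplecticScissors.PlanarCompilerProof

/-- **The vertical shear is a change-of-variables move.** Over an open base `G ⊆ ℝᵐ` let `α` be
`ℚ`-semialgebraic and differentiable. If `r` is a representation on the open band
`{(y, s) | y ∈ G, a y < s < b y}`, `r'` a representation on the open band
`{(y, s) | y ∈ G, α y + a y < s < α y + b y}`, both with integrand `1` on their domains, then
`[r] − [r']` is an instance of Kontsevich–Zagier's rule 2 along `Φ (y, s) = (y, α y + s)`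
(`ℚ`-semialgebraic, injective, differentiable, Jacobian determinant `1`).
[Kontsevich–Zagier 2001, §1.2, rule 2)] [folklore] -/
theorem band_shear_mem_changeOfVariablesRel {m : ℕ} {G : Set (Fin m → ℝ)}
    (hGo : IsOpen G) {α a b : (Fin m → ℝ) → ℝ}
    (hα : IsSemialgebraicFunOn ℚ G α) (hαd : DifferentiableOn ℝ α G)
    (r r' : KZ.IntegralRep (m + 1))
    (hr : r.domain = {z : Fin (m + 1) → ℝ | Fin.init z ∈ G ∧ a (Fin.init z) < z (Fin.last m) ∧
      z (Fin.last m) < b (Fin.init z)})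
    (hr' : r'.domain = {z : Fin (m + 1) → ℝ | Fin.init z ∈ G ∧
      α (Fin.init z) + a (Fin.init z) < z (Fin.last m) ∧
      z (Fin.last m) < α (Fin.init z) + b (Fin.init z)})
    (hr1 : ∀ z ∈ r.domain, r.integrand z = 1) (hr'1 : ∀ z ∈ r'.domain, r'.integrand z = 1) :
    KZ.of r - KZ.of r' ∈ KZ.changeOfVariablesRel := by
  -- adapted from `KZ.of_sub_of_mem_relations_of_affine` (KZLogCalculusProofs.lean)
  have hmemG : ∀ z ∈ r.domain, Fin.init z ∈ G := fun z hz => by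
    rw [hr] at hz
    exact hz.1
  have hαd' : ∀ y ∈ G, HasFDerivAt α (fderiv ℝ α y) y := fun y hy =>
    ((hαd y hy).differentiableAt (hGo.mem_nhds hy)).hasFDerivAt
  -- the substitution
  set Φ : (Fin (m + 1) → ℝ) → (Fin (m + 1) → ℝ) := fun z =>
    Fin.snoc (Fin.init z) (α (Fin.init z) + z (Fin.last m)) with hΦ
  -- continuous linear pieces
  let initL : (Fin (m + 1) → ℝ) →L[ℝ] (Fin m → ℝ) :=
    ContinuousLinearMap.pi fun i => ContinuousLinearMap.proj (Fin.castSucc i)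
  let lastL : (Fin (m + 1) → ℝ) →L[ℝ] ℝ := ContinuousLinearMap.proj (Fin.last m)
  have hinitL : ∀ w, initL w = Fin.init w := fun w => rfl
  have hlastL : ∀ w, lastL w = w (Fin.last m) := fun w => rfl
  let row : (Fin (m + 1) → ℝ) → (Fin (m + 1) → ℝ) →L[ℝ] ℝ := fun z =>
    (fderiv ℝ α (Fin.init z)).comp initL + lastL
  have hrow : ∀ z w, row z w = fderiv ℝ α (Fin.init z) (Fin.init w) + w (Fin.last m) := by
    intro z w
    simp [row, hinitL, hlastL]
  let Φ' : (Fin (m + 1) → ℝ) → (Fin (m + 1) → ℝ) →L[ℝ] (Fin (m + 1) → ℝ) := fun z =>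
    ContinuousLinearMap.pi
      (Fin.lastCases (motive := fun _ => (Fin (m + 1) → ℝ) →L[ℝ] ℝ) (row z)
        (fun i => ContinuousLinearMap.proj (Fin.castSucc i)))
  have hΦ' : ∀ z w, Φ' z w = Fin.snoc (Fin.init w) (row z w) := by
    intro z w
    funext i
    refine Fin.lastCases ?_ (fun j => ?_) i
    · simp [Φ']
    · simp [Φ', Fin.init]
  -- determinant
  have hdet : ∀ z, (Φ' z).det = 1 := by
    intro z
    have h := LinearMap.det_of_snoc_init (Φ' z : (Fin (m + 1) → ℝ) →ₗ[ℝ] (Fin (m + 1) → ℝ))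
      LinearMap.id ((fderiv ℝ α (Fin.init z) : (Fin m → ℝ) →L[ℝ] ℝ) : (Fin m → ℝ) →ₗ[ℝ] ℝ) 1
      (fun w => by
        rw [ContinuousLinearMap.coe_coe, hΦ', hrow]
        simp)
    rw [LinearMap.det_id, mul_one] at h
    exact h
  -- derivative
  have hderiv : ∀ z : Fin (m + 1) → ℝ, Fin.init z ∈ G → HasFDerivAt Φ (Φ' z) z := by
    intro z hz
    rw [hasFDerivAt_pi']
    intro i
    refine Fin.lastCases ?_ (fun j => ?_) i
    · have h1 : HasFDerivAt (fun x : Fin (m + 1) → ℝ => Fin.init x) initL z := initL.hasFDerivAt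
      have hαc := (hαd' _ hz).comp z h1
      have hl : HasFDerivAt (fun x : Fin (m + 1) → ℝ => x (Fin.last m)) lastL z :=
        hasFDerivAt_apply (Fin.last m) z
      have h := hαc.add hl
      have hfun : (fun x => Φ x (Fin.last m)) =
          fun x => (α ∘ fun x : Fin (m + 1) → ℝ => Fin.init x) x + x (Fin.last m) := by
        funext x
        simp [hΦ]
      show HasFDerivAt (fun x => Φ x (Fin.last m)) _ z
      rw [hfun]
      refine h.congr_fderiv (ContinuousLinearMap.ext fun w => ?_)
      simp only [ContinuousLinearMap.coe_comp, Function.comp_apply, hΦ', hrow]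
      simp [hinitL, hlastL]
    · have hfun : (fun x => Φ x (Fin.castSucc j)) = fun x => x (Fin.castSucc j) := by
        funext x
        simp [hΦ, Fin.init]
      show HasFDerivAt (fun x => Φ x (Fin.castSucc j)) _ z
      rw [hfun]
      refine (hasFDerivAt_apply (Fin.castSucc j) z).congr_fderiv
        (ContinuousLinearMap.ext fun w => ?_)
      simp [hΦ', Fin.init]
  -- semialgebraicity of the pieces on the band
  have hαi : IsSemialgebraicFunOn ℚ r.domain (fun z => α (Fin.init z)) :=
    hα.comp_init_mono r.isSemialgebraic_domain hmemG
  have hli := isSemialgebraicFunOn_apply r.isSemialgebraic_domain (Fin.last _)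
  -- the image
  have himage : r'.domain = Φ '' r.domain := by
    rw [hr']
    ext w
    simp only [mem_image]
    constructor
    · intro hw
      have hy : Fin.init w ∈ G := hw.1
      refine ⟨Fin.snoc (Fin.init w) (w (Fin.last m) - α (Fin.init w)), ?_, ?_⟩
      · rw [hr]
        refine ⟨by simpa using hy, ?_, ?_⟩
        · simp only [Fin.init_snoc, Fin.snoc_last]
          have := hw.2.1
          linarith
        · simp only [Fin.init_snoc, Fin.snoc_last]
          have := hw.2.2
          linarith
      · simp only [hΦ, Fin.init_snoc, Fin.snoc_last]
        rw [add_sub_cancel, Fin.snoc_init_self]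
    · rintro ⟨z, hz, rfl⟩
      have hy : Fin.init z ∈ G := hmemG z hz
      rw [hr] at hz
      refine ⟨by simpa [hΦ] using hy, ?_, ?_⟩
      · simp only [hΦ, Fin.init_snoc, Fin.snoc_last]
        have := hz.2.1
        linarith
      · simp only [hΦ, Fin.init_snoc, Fin.snoc_last]
        have := hz.2.2
        linarith
  refine ⟨m + 1, r, r', Φ, Φ', ?_, ?_, ?_, himage, ?_, rfl⟩
  · -- semialgebraic map
    refine (isSemialgebraicMapOn_iff_forall_holds r.isSemialgebraic_domain).mpr fun i => ?_
    refine Fin.lastCases ?_ (fun j => ?_) i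
    · exact (IsSemialgebraicFunOn.add_holds hαi hli).congr fun z _ => by simp [hΦ]
    · exact (isSemialgebraicFunOn_aeval r.isSemialgebraic_domain
        (MvPolynomial.X (Fin.castSucc j))).congr fun z _ => by simp [hΦ, Fin.init]
  · exact fun z hz => (hderiv z (hmemG z hz)).hasFDerivWithinAt
  · intro z₁ _ z₂ _ h
    have hy : Fin.init z₁ = Fin.init z₂ := by
      have := congrArg Fin.init h
      simpa [hΦ] using this
    have hl : α (Fin.init z₁) + z₁ (Fin.last m) = α (Fin.init z₂) + z₂ (Fin.last m) := by
      have := congrFun h (Fin.last m)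
      simpa [hΦ] using this
    rw [hy] at hl
    have hs : z₁ (Fin.last m) = z₂ (Fin.last m) := add_left_cancel hl
    rw [← Fin.snoc_init_self z₁, ← Fin.snoc_init_self z₂, hy, hs]
  · intro z hz
    have hΦz : Φ z ∈ r'.domain := himage ▸ mem_image_of_mem Φ hz
    rw [hr1 z hz, hr'1 _ hΦz, hdet, abs_one, mul_one]


open Summit.KontsevichZagierPeriods.SymplecticScissors.PlanarK0InjectiveNegative

/-- **The strip between two graphs is `Θ` of the difference, modulo the planar set-chain group.**
Let `Θ` be a cell compiler (it sends a 1-dimensional `[∫_σ f]` to `[cell of f⁺] − [cell of f⁻]`)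
mapping every instance of rules 1a / 1b / 2 into the planar set-chain group `G`. For two
1-dimensional representations `ρ₁, ρ₂` on a common domain `σ` with `ρ₁.integrand < ρ₂.integrand` on
`σ`, and an integrand-`1` planar representation `r` on the open strip
`{(x, v) | x ∈ σ, f₁ x < v < f₂ x}`, one has `[r] ≡ Θ[ρ₂] − Θ[ρ₁] (mod G)`: off a null
`ℚ`-semialgebraic subset of `σ` where `f₁` fails to be smooth (whose vertical cylinder is null, rule 1a)
the shear `(x, v) ↦ (x, v − f₁ x)` (rule 2, `band_shear_mem_changeOfVariablesRel`) carries
the strip onto the `Θ`-cell of `[∫_σ (f₂ − f₁)]`, and `[ρ₂] − [ρ₁] − [∫_σ (f₂ − f₁)]` is an instance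
of rule 1b, killed by `Θ`. [Kontsevich–Zagier 2001, §1.2] [folklore] -/
theorem band_strip_sub_mem_planarGroup (Θ : KZ.FormalRep →+ KZ.FormalRep)
    (hΘ : (∀ ρ : KZ.IntegralRep 1, ∃ s t : KZ.IntegralRep 2, s.domain = {p : Fin 2 → ℝ | (fun _ : Fin 1 => p 0) ∈ ρ.domain ∧ 0 < p 1 ∧ p 1 < ρ.integrand (fun _ : Fin 1 => p 0)} ∧ t.domain = {p : Fin 2 → ℝ | (fun _ : Fin 1 => p 0) ∈ ρ.domain ∧ 0 < p 1 ∧ p 1 < -ρ.integrand (fun _ : Fin 1 => p 0)} ∧ (∀ p ∈ s.domain, s.integrand p = 1) ∧ (∀ p ∈ t.domain, t.integrand p = 1) ∧ Θ (KZ.of ρ) = KZ.of s - KZ.of t) ∧ (∀ (n : ℕ) (ρ : KZ.IntegralRep n), n ≠ 1 → Θ (KZ.of ρ) = 0))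
    (hmoves : ∀ x ∈ KZ.domainAddRel ∪ KZ.integrandAddRel ∪ KZ.changeOfVariablesRel,
      Θ x ∈ planarGroup)
    (ρ₁ ρ₂ : KZ.IntegralRep 1) (r : KZ.IntegralRep 2) (hdom : ρ₂.domain = ρ₁.domain)
    (hlt : ∀ z ∈ ρ₁.domain, ρ₁.integrand z < ρ₂.integrand z)
    (hr : r.domain = {p : Fin 2 → ℝ | (fun _ : Fin 1 => p 0) ∈ ρ₁.domain ∧
      ρ₁.integrand (fun _ : Fin 1 => p 0) < p 1 ∧ p 1 < ρ₂.integrand (fun _ : Fin 1 => p 0)})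
    (hr1 : ∀ q ∈ r.domain, r.integrand q = 1) :
    KZ.of r - (Θ (KZ.of ρ₂) - Θ (KZ.of ρ₁)) ∈ planarGroup := by
  -- the base point of a point of the plane (`Fin.init`) and vertical cylinders
  have hinit : ∀ p : Fin 2 → ℝ, Fin.init p = fun _ : Fin 1 => p 0 := fun p => by
    funext i
    rw [Subsingleton.elim i 0]
    rfl
  have hcyl_sa : ∀ {S : Set (Fin 1 → ℝ)}, IsSemialgebraic ℚ S →
      IsSemialgebraic ℚ {p : Fin 2 → ℝ | (fun _ : Fin 1 => p 0) ∈ S} := fun hS =>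
    hS.preimage_comp (fun _ : Fin 1 => (0 : Fin 2))
  have hcyl_null : ∀ {N : Set (Fin 1 → ℝ)}, volume N = 0 →
      volume {p : Fin 2 → ℝ | (fun _ : Fin 1 => p 0) ∈ N} = 0 := fun hN => by
    simpa only [hinit] using KZ.volume_setOf_init_mem_eq_zero (n := 1) hN
  have hgen : ∀ s : KZ.IntegralRep 2, (∀ p ∈ s.domain, s.integrand p = 1) →
      KZ.of s ∈ AddSubgroup.closure planarGens := fun s hs =>
    AddSubgroup.subset_closure ⟨s, hs, rfl⟩
  -- the difference representation `[∫_σ (f₂ − f₁)]`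
  let ρd : KZ.IntegralRep 1 :=
    { domain := ρ₁.domain
      integrand := ρ₂.integrand - ρ₁.integrand
      isSemialgebraic_domain := ρ₁.isSemialgebraic_domain
      isSemialgebraicFunOn_integrand := IsSemialgebraicFunOn.sub_holds
        (by simpa only [hdom] using ρ₂.isSemialgebraicFunOn_integrand)
        ρ₁.isSemialgebraicFunOn_integrand
      integrableOn := (by simpa only [hdom] using ρ₂.integrableOn : IntegrableOn ρ₂.integrand
        ρ₁.domain).sub ρ₁.integrableOn }
  have hρd_pos : ∀ z ∈ ρ₁.domain, 0 < ρd.integrand z := fun z hz => by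
    show 0 < ρ₂.integrand z - ρ₁.integrand z
    linarith [hlt z hz]
  -- rule 1b: `[ρ₂] − [ρ₁] − [ρd]`
  have h1b : KZ.of ρ₂ - KZ.of ρ₁ - KZ.of ρd ∈ KZ.integrandAddRel :=
    ⟨1, ρ₂, ρ₁, ρd, hdom.symm, hdom.symm, fun z _ => by simp [ρd], rfl⟩
  have hG1b : Θ (KZ.of ρ₂) - Θ (KZ.of ρ₁) - Θ (KZ.of ρd) ∈ planarGroup := by
    simpa only [map_sub] using hmoves _ (Or.inl (Or.inr h1b))
  -- generic smoothness of `f₁`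
  obtain ⟨G₀, hG₀D, hG₀o, hG₀sa, hG₀smooth, hZsa, hZ0⟩ :=
    KZ.exists_isOpen_contDiffOn ρ₁.isSemialgebraic_domain ρ₁.isSemialgebraicFunOn_integrand
  -- rule 1a in dimension one: `[ρd] − [ρd|G₀] − [ρd|σ∖G₀]`
  let ρdG : KZ.IntegralRep 1 := ρd.restrict G₀ hG₀sa hG₀D
  let ρdZ : KZ.IntegralRep 1 := ρd.restrict (ρ₁.domain \ G₀) hZsa Set.sdiff_subset
  have h1a : KZ.of ρd - KZ.of ρdG - KZ.of ρdZ ∈ KZ.domainAddRel := by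
    refine ⟨1, ρd, ρdG, ρdZ, ?_, ?_, fun _ _ => rfl, fun _ _ => rfl, rfl⟩
    · show ρ₁.domain = G₀ ∪ (ρ₁.domain \ G₀)
      rw [Set.union_sdiff_cancel hG₀D]
    · show volume (G₀ ∩ (ρ₁.domain \ G₀)) = 0
      rw [Set.inter_sdiff_self, measure_empty]
  have hG1a : Θ (KZ.of ρd) - Θ (KZ.of ρdG) - Θ (KZ.of ρdZ) ∈ planarGroup := by
    simpa only [map_sub] using hmoves _ (Or.inl (Or.inl h1a))
  -- the cells of the two pieces
  obtain ⟨sG, tG, hsG, htG, hsG1, htG1, hΘG⟩ := hΘ.1 ρdG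
  obtain ⟨sZ, tZ, hsZ, htZ, hsZ1, htZ1, hΘZ⟩ := hΘ.1 ρdZ
  have hcylZ : volume {p : Fin 2 → ℝ | (fun _ : Fin 1 => p 0) ∈ ρ₁.domain \ G₀} = 0 :=
    hcyl_null hZ0
  have hsZ0 : KZ.of sZ ∈ planarGroup :=
    of_mem_planarGroup_of_volume_eq_zero sZ hsZ1
      (measure_mono_null (fun p hp => by rw [hsZ] at hp; exact hp.1) hcylZ)
  have htZ0 : KZ.of tZ ∈ planarGroup :=
    of_mem_planarGroup_of_volume_eq_zero tZ htZ1
      (measure_mono_null (fun p hp => by rw [htZ] at hp; exact hp.1) hcylZ)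
  have htG0 : KZ.of tG ∈ planarGroup := by
    refine of_mem_planarGroup_of_volume_eq_zero tG htG1 ?_
    have hempty : tG.domain = ∅ := by
      rw [htG, Set.eq_empty_iff_forall_notMem]
      rintro p ⟨hp0, hp1, hp2⟩
      have hpos := hρd_pos _ (hG₀D hp0)
      have : ρdG.integrand (fun _ : Fin 1 => p 0) = ρd.integrand (fun _ : Fin 1 => p 0) := rfl
      rw [this] at hp2
      linarith
    rw [hempty, measure_empty]
  -- rule 1a in the plane: `[r] − [r|cyl G₀] − [r|cyl (σ∖G₀)]`
  set cylG : Set (Fin 2 → ℝ) := {p : Fin 2 → ℝ | (fun _ : Fin 1 => p 0) ∈ G₀} with hcylG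
  have hcylG_sa : IsSemialgebraic ℚ cylG := hcyl_sa hG₀sa
  let rG : KZ.IntegralRep 2 :=
    r.restrict (r.domain ∩ cylG) (r.isSemialgebraic_domain.inter hcylG_sa) inter_subset_left
  let rZ : KZ.IntegralRep 2 :=
    r.restrict (r.domain \ cylG) (r.isSemialgebraic_domain.diff hcylG_sa) Set.sdiff_subset
  have hrG1 : ∀ q ∈ rG.domain, rG.integrand q = 1 := fun q hq => hr1 q hq.1
  have hrZ1 : ∀ q ∈ rZ.domain, rZ.integrand q = 1 := fun q hq => hr1 q hq.1
  have h1a' : KZ.of r - KZ.of rG - KZ.of rZ ∈ KZ.domainAddRel := by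
    refine ⟨2, r, rG, rZ, ?_, ?_, fun _ _ => rfl, fun _ _ => rfl, rfl⟩
    · show r.domain = (r.domain ∩ cylG) ∪ (r.domain \ cylG)
      rw [Set.inter_union_sdiff]
    · show volume ((r.domain ∩ cylG) ∩ (r.domain \ cylG)) = 0
      have : (r.domain ∩ cylG) ∩ (r.domain \ cylG) = ∅ := by
        ext p
        simp only [mem_inter_iff, Set.mem_sdiff, mem_empty_iff_false, iff_false, not_and, not_not,
          and_imp]
        exact fun _ h _ => h
      rw [this, measure_empty]
  have hG1a' : KZ.of r - KZ.of rG - KZ.of rZ ∈ planarGroup :=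
    AddSubgroup.subset_closure ⟨Or.inl h1a', sub_mem (sub_mem (hgen r hr1) (hgen rG hrG1))
      (hgen rZ hrZ1)⟩
  have hrZ0 : KZ.of rZ ∈ planarGroup := by
    refine of_mem_planarGroup_of_volume_eq_zero rZ hrZ1 (measure_mono_null ?_ hcylZ)
    rintro p ⟨hp, hpc⟩
    rw [hr] at hp
    exact ⟨hp.1, hpc⟩
  -- rule 2: the shear carries `r|cyl G₀` onto the cell `sG`
  have hcov : KZ.of rG - KZ.of sG ∈ KZ.changeOfVariablesRel := by
    refine band_shear_mem_changeOfVariablesRel (m := 1) hG₀o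
      (α := fun y => -ρ₁.integrand y) (a := ρ₁.integrand) (b := ρ₂.integrand)
      ((ρ₁.isSemialgebraicFunOn_integrand.mono hG₀D hG₀sa).neg)
      ((hG₀smooth.differentiableOn (by simp)).neg) rG sG ?_ ?_ hrG1 hsG1
    · show r.domain ∩ cylG = _
      rw [hr]
      ext z
      simp only [mem_inter_iff, mem_setOf_eq, hcylG, hinit]
      exact ⟨fun h => ⟨h.2, h.1.2.1, h.1.2.2⟩, fun h => ⟨⟨hG₀D h.1, h.2.1, h.2.2⟩, h.1⟩⟩
    · rw [hsG]
      ext z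
      have hlast : (Fin.last 1 : Fin 2) = 1 := rfl
      simp only [mem_setOf_eq, hinit, hlast, KZ.IntegralRep.domain_restrict,
        KZ.IntegralRep.integrand_restrict, ρdG, ρd, Pi.sub_apply]
      constructor
      · rintro ⟨h0, h1, h2⟩
        exact ⟨h0, by linarith, by linarith⟩
      · rintro ⟨h0, h1, h2⟩
        exact ⟨h0, by linarith, by linarith⟩
  have hGcov : KZ.of rG - KZ.of sG ∈ planarGroup :=
    AddSubgroup.subset_closure ⟨Or.inr hcov, sub_mem (hgen rG hrG1) (hgen sG hsG1)⟩
  -- bookkeeping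
  have key : KZ.of r - (Θ (KZ.of ρ₂) - Θ (KZ.of ρ₁)) =
      (KZ.of r - KZ.of rG - KZ.of rZ) + KZ.of rZ + (KZ.of rG - KZ.of sG) + KZ.of tG
        - (Θ (KZ.of ρd) - Θ (KZ.of ρdG) - Θ (KZ.of ρdZ)) - KZ.of sZ + KZ.of tZ
        - (Θ (KZ.of ρ₂) - Θ (KZ.of ρ₁) - Θ (KZ.of ρd)) := by
    rw [hΘG, hΘZ]
    abel
  rw [key]
  exact sub_mem (add_mem (sub_mem (sub_mem (add_mem (add_mem (add_mem hG1a' hrZ0) hGcov) htG0)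
    hG1a) hsZ0) htZ0) hG1b


/-- **Anchor of this helper file** (registered stub `stub_band_aux` of the crux item): the vertical
shear `Φ (y, s) = (y, α y + s)` between integrand-`1` representations on the open bands with edges
`(a, b)` and `(α + a, α + b)` over an open base where `α` is `ℚ`-semialgebraic and differentiable is
one instance of Kontsevich–Zagier's rule 2 (`band_shear_mem_changeOfVariablesRel`).
[Kontsevich–Zagier 2001, §1.2, rule 2)] [folklore] -/
theorem stub_band_aux :
    ∀ (m : ℕ) (G : Set (Fin m → ℝ)) (α a b : (Fin m → ℝ) → ℝ) (r r' : KZ.IntegralRep (m + 1)), IsOpen G → IsSemialgebraicFunOn ℚ G α → DifferentiableOn ℝ α G → r.domain = {z : Fin (m + 1) → ℝ | Fin.init z ∈ G ∧ a (Fin.init z) < z (Fin.last m) ∧ z (Fin.last m) < b (Fin.init z)} → r'.domain = {z : Fin (m + 1) → ℝ | Fin.init z ∈ G ∧ α (Fin.init z) + a (Fin.init z) < z (Fin.last m) ∧ z (Fin.last m) < α (Fin.init z) + b (Fin.init z)} → (∀ z ∈ r.domain, r.integrand z = 1) → (∀ z ∈ r'.domain, r'.integrand z = 1) → KZ.of r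 - KZ.of r' ∈ KZ.changeOfVariablesRel :=
  fun _ _ _ _ _ r r' hGo hα hαd hr hr' hr1 hr'1 =>
    band_shear_mem_changeOfVariablesRel hGo hα hαd r r' hr hr' hr1 hr'1

end Summit.KontsevichZagierPeriods.SymplecticScissors.PlanarCompilerProof
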